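import Mathlib.Algebra.Group.Submonoid.Operations
import Literature.AlgebraicGeometry.Frobenioids.Monoids
import Literature.AlgebraicGeometry.Frobenioids.MonoidFunctors
import Literature.AlgebraicGeometry.Frobenioids.ElementaryFrobenioid
import Literature.AlgebraicGeometry.Frobenioids.MonoidRealification
import HarnessLib

/-!
# Frobenioids I, §0: transport of the monoid dictionary along isomorphisms of monoids

Mochizuki, *The geometry of Frobenioids I*, Kyushu J. Math. **62** (2008), §0 "Monoids", kurims
pp. 10–12 [cite: MochizukiFrdI2008, §0 pp.10-12].  Every notion of the §0 dictionary
(`Monoids.lean`: `≼`, primary elements, `Prime(M)`, the subsets `𝔭 ⊆ M` and submonoids `M_𝔭`,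
sharp / integral / saturated / of characteristic type / perfect, (pre-)divisorial (Def. 1.1 (i)),
`Λ`-monoprime, bounded subsets, the completion `M ⊗ ℝ_{≥0}`) is invariant under an isomorphism of
monoids `e : N ≅ N'`.  The paper uses this tacitly whenever it identifies a perfect monoid with its
perfection or a monoid with an isomorphic copy (e.g. Def. 2.4 (i), p. 48: "one verifies immediately
that `M^pf`, `M^rlf` are also perf-factorial"); this file supplies the transport lemmas, used by the
proofs of those closing claims of Def. 2.4 (i).  Nothing here is specific to Frobenioids; no
statement of the paper is strengthened.  Multiplicative notation as in `Monoids.lean`.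
-/

namespace Literature.AlgebraicGeometry.Frobenioids

open Function

universe u

variable {N N' : Type u} [CommMonoid N] [CommMonoid N']

/-! ### `≼`, primary elements and primes -/

/-- `≼` is preserved and reflected by isomorphisms. [cite: MochizukiFrdI2008, §0 p.12] -/
theorem precsim_map_iff (e : N ≃* N') {a b : N} : e a ≼ e b ↔ a ≼ b := by
  refine ⟨fun h => ?_, Precsim.map e.toMonoidHom⟩
  have h' := Precsim.map e.symm.toMonoidHom h
  simpa using h'

/-- Primary elements are preserved by isomorphisms. [cite: MochizukiFrdI2008, §0 p.12] -/
theorem IsPrimary.map_mulEquiv (e : N ≃* N') {a : N} (h : IsPrimary a) : IsPrimary (e a) := by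
  refine ⟨fun h1 => h.1 (by simpa using congrArg e.symm h1), fun b hb hba => ?_⟩
  have hb' : e.symm b ≠ 1 := fun h1 => hb (by simpa using congrArg e h1)
  have hba' : e.symm b ≼ a := by
    rw [← precsim_map_iff e]
    simpa using hba
  simpa using (precsim_map_iff e).mpr (h.2 _ hb' hba')

/-- `a` is primary iff `e a` is. [cite: MochizukiFrdI2008, §0 p.12] -/
theorem isPrimary_map_iff (e : N ≃* N') {a : N} : IsPrimary (e a) ↔ IsPrimary a :=
  ⟨fun h => by simpa using h.map_mulEquiv e.symm, fun h => h.map_mulEquiv e⟩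

namespace Primes

/-- The map `Prime(N) → Prime(N')` induced by an isomorphism `e : N ≅ N'`.
[cite: MochizukiFrdI2008, §0 p.12] -/
def congrFun (e : N ≃* N') : Primes N → Primes N' :=
  Quotient.map (fun a => ⟨e a, a.2.map_mulEquiv e⟩) fun _ _ h => Precsim.map e.toMonoidHom h

/-- `congrFun e` on the class of a primary element. [cite: MochizukiFrdI2008, §0 p.12] -/
theorem congrFun_mk (e : N ≃* N') (a : N) (h : IsPrimary a) :
    congrFun e (Quotient.mk (primarySetoid N) ⟨a, h⟩) =
      Quotient.mk (primarySetoid N') ⟨e a, h.map_mulEquiv e⟩ := rfl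

/-- `congrFun e.symm` is a left inverse of `congrFun e`. [cite: MochizukiFrdI2008, §0 p.12] -/
theorem congrFun_symm_congrFun (e : N ≃* N') (𝔭 : Primes N) :
    congrFun e.symm (congrFun e 𝔭) = 𝔭 := by
  induction 𝔭 using Quotient.inductionOn with
  | h a =>
    rw [congrFun_mk, congrFun_mk]
    exact congrArg (Quotient.mk (primarySetoid N)) (Subtype.ext (e.symm_apply_apply a.1))

/-- **`Prime(N) ≅ Prime(N')`** for an isomorphism `e : N ≅ N'` of monoids.
[cite: MochizukiFrdI2008, §0 p.12] -/
def congr (e : N ≃* N') : Primes N ≃ Primes N' where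
  toFun := congrFun e
  invFun := congrFun e.symm
  left_inv := congrFun_symm_congrFun e
  right_inv 𝔭' := by simpa using congrFun_symm_congrFun e.symm 𝔭'

/-- `congr e` on the class of a primary element. [cite: MochizukiFrdI2008, §0 p.12] -/
theorem congr_mk (e : N ≃* N') (a : N) (h : IsPrimary a) (h' : IsPrimary (e a)) :
    congr e (Quotient.mk (primarySetoid N) ⟨a, h⟩) = Quotient.mk (primarySetoid N') ⟨e a, h'⟩ := rfl

/-- `(congr e)⁻¹ = congr e⁻¹`. [cite: MochizukiFrdI2008, §0 p.12] -/
@[simp] theorem congr_symm (e : N ≃* N') : (congr e).symm = congr e.symm := rfl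

/-- `congr e⁻¹ (congr e 𝔭) = 𝔭`. [cite: MochizukiFrdI2008, §0 p.12] -/
@[simp] theorem congr_symm_apply_congr (e : N ≃* N') (𝔭 : Primes N) :
    congr e.symm (congr e 𝔭) = 𝔭 := congrFun_symm_congrFun e 𝔭

/-- `congr e (congr e⁻¹ 𝔭') = 𝔭'`. [cite: MochizukiFrdI2008, §0 p.12] -/
@[simp] theorem congr_apply_congr_symm (e : N ≃* N') (𝔭' : Primes N') :
    congr e (congr e.symm 𝔭') = 𝔭' := (congr e).apply_symm_apply 𝔭'

/-- The subset of the transported prime is the image of the subset: `(e 𝔭) = e(𝔭) ⊆ N'`.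
[cite: MochizukiFrdI2008, §0 p.12] -/
theorem mem_carrier_congr_iff (e : N ≃* N') (𝔭 : Primes N) (x' : N') :
    x' ∈ (congr e 𝔭).carrier ↔ e.symm x' ∈ 𝔭.carrier := by
  constructor
  · rintro ⟨h', h𝔭⟩
    refine ⟨h'.map_mulEquiv e.symm, ?_⟩
    have := congrArg (congr e.symm) h𝔭
    rw [congr_symm_apply_congr] at this
    rw [← this]
    rfl
  · rintro ⟨h, h𝔭⟩
    refine ⟨by simpa using h.map_mulEquiv e, ?_⟩
    rw [← h𝔭, congr_mk e _ h (by simpa using h.map_mulEquiv e)]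
    exact congrArg (Quotient.mk (primarySetoid N')) (Subtype.ext (e.apply_symm_apply x').symm)

/-- `(congr e 𝔭).carrier = e '' 𝔭.carrier`. [cite: MochizukiFrdI2008, §0 p.12] -/
theorem carrier_congr (e : N ≃* N') (𝔭 : Primes N) : (congr e 𝔭).carrier = e '' 𝔭.carrier := by
  ext x'
  rw [mem_carrier_congr_iff]
  constructor
  · intro h
    exact ⟨e.symm x', h, e.apply_symm_apply x'⟩
  · rintro ⟨x, hx, rfl⟩
    rw [e.symm_apply_apply]
    exact hx

/-- `N'_{e 𝔭} = e(N_𝔭)`: the submonoid generated by the transported prime is the image submonoid.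
[cite: MochizukiFrdI2008, §0 p.12] -/
theorem submonoid_congr (e : N ≃* N') (𝔭 : Primes N) :
    (congr e 𝔭).submonoid = 𝔭.submonoid.map (e : N →* N') := by
  rw [Primes.submonoid, Primes.submonoid, MonoidHom.map_mclosure, carrier_congr]
  rfl

/-- Membership in `N'_{e 𝔭}`. [cite: MochizukiFrdI2008, §0 p.12] -/
theorem mem_submonoid_congr_iff (e : N ≃* N') (𝔭 : Primes N) (x' : N') :
    x' ∈ (congr e 𝔭).submonoid ↔ e.symm x' ∈ 𝔭.submonoid := by
  rw [submonoid_congr, Submonoid.mem_map]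
  constructor
  · rintro ⟨x, hx, rfl⟩
    simpa using hx
  · intro h
    exact ⟨e.symm x', h, by simp⟩

/-- **`N_𝔭 ≅ N'_{𝔭'}`** for `𝔭' = e(𝔭)`: the restriction of `e` (stated with an equation `h` so that
no transport of the index is needed downstream). [cite: MochizukiFrdI2008, §0 p.12] -/
def submonoidCongr (e : N ≃* N') (𝔭 : Primes N) (𝔭' : Primes N') (h : congr e 𝔭 = 𝔭') :
    ↥𝔭.submonoid ≃* ↥𝔭'.submonoid where
  toFun x := ⟨e x, by rw [← h, mem_submonoid_congr_iff, e.symm_apply_apply]; exact x.2⟩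
  invFun y := ⟨e.symm y, by rw [← mem_submonoid_congr_iff, h]; exact y.2⟩
  left_inv x := Subtype.ext (e.symm_apply_apply x.1)
  right_inv y := Subtype.ext (e.apply_symm_apply y.1)
  map_mul' x y := Subtype.ext (map_mul e x.1 y.1)

/-- `submonoidCongr` acts by `e` on underlying elements. [cite: MochizukiFrdI2008, §0 p.12] -/
@[simp] theorem coe_submonoidCongr_apply (e : N ≃* N') (𝔭 : Primes N) (𝔭' : Primes N')
    (h : congr e 𝔭 = 𝔭') (x : ↥𝔭.submonoid) : (submonoidCongr e 𝔭 𝔭' h x : N') = e x := rfl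

/-- The inverse of `submonoidCongr` acts by `e⁻¹`. [cite: MochizukiFrdI2008, §0 p.12] -/
@[simp] theorem coe_submonoidCongr_symm_apply (e : N ≃* N') (𝔭 : Primes N) (𝔭' : Primes N')
    (h : congr e 𝔭 = 𝔭') (y : ↥𝔭'.submonoid) :
    ((submonoidCongr e 𝔭 𝔭' h).symm y : N) = e.symm y := rfl

end Primes

/-! ### The basic predicates -/

/-- Sharpness is invariant under isomorphism. [cite: MochizukiFrdI2008, §0 p.11] -/
theorem IsSharp.of_mulEquiv (e : N ≃* N') (h : IsSharp N) : IsSharp N' :=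
  ⟨fun a ha => by simpa using congrArg e (h.1 (e.symm a) (by simpa using ha.map e.symm))⟩

/-- Torsion-freeness is invariant under isomorphism. [cite: MochizukiFrdI2008, §0 p.11] -/
theorem IsTorsionFree.of_mulEquiv (e : N ≃* N') (h : IsTorsionFree N) : IsTorsionFree N' :=
  ⟨fun a n hn han => by
    have := h.1 (e.symm a) n hn (by rw [← map_pow, han, map_one])
    simpa using congrArg e this⟩

/-- Integrality (= cancellativity) is invariant under isomorphism. [cite: MochizukiFrdI2008, §0 p.11] -/
theorem IsIntegral.of_mulEquiv (e : N ≃* N') (h : IsIntegral N) : IsIntegral N' := by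
  rw [isIntegral_iff_isCancelMul] at h ⊢
  haveI := h
  haveI : IsLeftCancelMul N' := ⟨fun a b c habc => by
    have : e.symm a * e.symm b = e.symm a * e.symm c := by
      rw [← map_mul, ← map_mul]
      exact congrArg e.symm habc
    simpa using congrArg e (mul_left_cancel this)⟩
  exact CommMagma.IsLeftCancelMul.toIsCancelMul _

/-- Saturatedness is invariant under isomorphism (via the functoriality of `M^gp`).
[cite: MochizukiFrdI2008, §0 p.11] -/
theorem IsSaturated.of_mulEquiv (e : N ≃* N') (h : IsSaturated N) : IsSaturated N' := by
  refine ⟨fun x n hn ⟨m', hx⟩ => ?_⟩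
  -- pull back along `gpMap e⁻¹`, saturate in `N`, push forward along `gpMap e`
  have hback : (gpMap (e.symm : N' →* N) x) ^ n ∈ Set.range (Algebra.GrothendieckGroup.of (M := N)) :=
    ⟨e.symm m', by rw [← map_pow, ← hx, gpMap_of]; rfl⟩
  obtain ⟨m, hm⟩ := h.1 _ n hn hback
  refine ⟨e m, ?_⟩
  have hcomp : (gpMap (e : N →* N')).comp (gpMap (e.symm : N' →* N)) = MonoidHom.id _ := by
    rw [← gpMap_comp, show (e : N →* N').comp (e.symm : N' →* N) = MonoidHom.id N' from
      MonoidHom.ext fun y => e.apply_symm_apply y, gpMap_id]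
  have hx' : gpMap (e : N →* N') (gpMap (e.symm : N' →* N) x) = x :=
    DFunLike.congr_fun hcomp x
  rw [← hx', ← hm, gpMap_of]
  rfl

/-- Being of characteristic type is invariant under isomorphism. [cite: MochizukiFrdI2008, §0 p.11] -/
theorem IsOfCharType.of_mulEquiv (e : N ≃* N') (h : IsOfCharType N) : IsOfCharType N' :=
  ⟨fun u a hua => by
    have h1 := h.1 (Units.map (e.symm : N' →* N) u) (e.symm a) (by
      rw [Units.coe_map, MonoidHom.coe_coe, ← map_mul, hua])
    ext
    have h2 := congrArg (fun v : Nˣ => e (v : N)) h1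
    simpa using h2⟩

/-- Perfectness is invariant under isomorphism. [cite: MochizukiFrdI2008, §0 p.11] -/
theorem IsPerfect.of_mulEquiv (e : N ≃* N') (h : IsPerfect N) : IsPerfect N' :=
  ⟨fun n hn => by
    have hcomm : (fun a : N' => a ^ n) = e ∘ (fun a : N => a ^ n) ∘ e.symm := by
      funext a
      simp [map_pow]
    rw [hcomm]
    exact e.bijective.comp ((h.1 n hn).comp e.symm.bijective)⟩

/-- Pre-divisoriality (Def. 1.1 (i)) is invariant under isomorphism. [cite: MochizukiFrdI2008, Def. 1.1(i) p.19] -/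
theorem IsPreDivisorial.of_mulEquiv (e : N ≃* N') (h : IsPreDivisorial N) : IsPreDivisorial N' where
  isIntegral := h.isIntegral.of_mulEquiv e
  isSaturated := h.isSaturated.of_mulEquiv e
  isOfCharType := h.isOfCharType.of_mulEquiv e

/-- Divisoriality (Def. 1.1 (i)) is invariant under isomorphism. [cite: MochizukiFrdI2008, Def. 1.1(i) p.19] -/
theorem IsDivisorial.of_mulEquiv (e : N ≃* N') (h : IsDivisorial N) : IsDivisorial N' where
  isPreDivisorial := h.isPreDivisorial.of_mulEquiv e
  isSharp := h.isSharp.of_mulEquiv e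

/-- `ℤ`-monoprimality is invariant under isomorphism. [cite: MochizukiFrdI2008, §0 p.10] -/
theorem IsZMonoprime.of_mulEquiv (e : N ≃* N') (h : IsZMonoprime N) : IsZMonoprime N' := by
  obtain ⟨⟨f⟩⟩ := h
  exact ⟨⟨e.symm.trans f⟩⟩

/-- `ℚ`-monoprimality is invariant under isomorphism. [cite: MochizukiFrdI2008, §0 p.10] -/
theorem IsQMonoprime.of_mulEquiv (e : N ≃* N') (h : IsQMonoprime N) : IsQMonoprime N' := by
  obtain ⟨⟨f⟩⟩ := h
  exact ⟨⟨e.symm.trans f⟩⟩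

/-- `ℝ`-monoprimality is invariant under isomorphism. [cite: MochizukiFrdI2008, §0 p.10] -/
theorem IsRMonoprime.of_mulEquiv (e : N ≃* N') (h : IsRMonoprime N) : IsRMonoprime N' := by
  obtain ⟨⟨f⟩⟩ := h
  exact ⟨⟨e.symm.trans f⟩⟩

/-- Monoprimality is invariant under isomorphism. [cite: MochizukiFrdI2008, §0 p.10] -/
theorem IsMonoprime.of_mulEquiv (e : N ≃* N') (h : IsMonoprime N) : IsMonoprime N' := by
  cases h with
  | ofZ h => exact IsMonoprime.ofZ (h.of_mulEquiv e)
  | ofQ h => exact IsMonoprime.ofQ (h.of_mulEquiv e)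
  | ofR h => exact IsMonoprime.ofR (h.of_mulEquiv e)

/-! ### Bounded subsets -/

/-- `e(S)` is bounded by `e b` iff `S` is bounded by `b`. [cite: MochizukiFrdI2008, §0 p.12] -/
theorem isBoundedBy_image_iff (e : N ≃* N') (S : Set N) (b : N) :
    IsBoundedBy (e '' S) (e b) ↔ IsBoundedBy S b := by
  constructor
  · intro h a ha
    have := h (e a) ⟨a, ha, rfl⟩
    rwa [map_dvd_iff] at this
  · rintro h _ ⟨a, ha, rfl⟩
    exact (map_dvd_iff e).mpr (h a ha)

/-- `e(S)` is bounded by `b'` iff `S` is bounded by `e⁻¹ b'`. [cite: MochizukiFrdI2008, §0 p.12] -/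
theorem isBoundedBy_image_iff' (e : N ≃* N') (S : Set N) (b' : N') :
    IsBoundedBy (e '' S) b' ↔ IsBoundedBy S (e.symm b') := by
  rw [← isBoundedBy_image_iff e S (e.symm b'), e.apply_symm_apply]

/-! ### The completion `M ⊗ ℝ_{≥0}` -/

/-- `N^∨ ≅ N'^∨` induced by `e : N ≅ N'` (precomposition with `e⁻¹`). [cite: MochizukiFrdI2008, §0 p.10] -/
def RDual.congr (e : N ≃* N') : RDual N ≃* RDual N' := e.monoidHomCongrLeft

/-- `RDual.congr e f = f ∘ e⁻¹`. [cite: MochizukiFrdI2008, §0 p.10] -/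
@[simp] theorem RDual.congr_apply (e : N ≃* N') (f : RDual N) (x' : N') :
    RDual.congr e f x' = f (e.symm x') := rfl

/-- **`N ⊗ ℝ_{≥0} ≅ N' ⊗ ℝ_{≥0}`** induced by `e : N ≅ N'` (double transpose).
[cite: MochizukiFrdI2008, §0 p.10] -/
def Realification.congr (e : N ≃* N') : Realification N ≃* Realification N' :=
  RDual.congr (RDual.congr e)

/-- `Realification.congr e s f' = s (f' ∘ e)`. [cite: MochizukiFrdI2008, §0 p.10] -/
theorem Realification.congr_apply (e : N ≃* N') (s : Realification N) (f' : RDual N') :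
    (show RDual N' →* Multiplicative NNReal from Realification.congr e s) f' =
      (show RDual N →* Multiplicative NNReal from s) ((RDual.congr e).symm f') := rfl

/-- `Realification.congr e` is `Realification.map e` (as a function). [cite: MochizukiFrdI2008, §0 p.10] -/
theorem Realification.congr_apply_eq_map (e : N ≃* N') (s : Realification N) :
    Realification.congr e s = Realification.map (e : N →* N') s := by
  apply MonoidHom.ext
  intro f'
  rw [Realification.congr_apply]
  show (show RDual N →* Multiplicative NNReal from s) _ =
    (show RDual N →* Multiplicative NNReal from s) _
  congr 1

/-- Naturality: `Realification.congr e (of a) = of (e a)`. [cite: MochizukiFrdI2008, §0 p.10] -/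
@[simp] theorem Realification.congr_of (e : N ≃* N') (a : N) :
    Realification.congr e (Realification.of N a) = Realification.of N' (e a) := by
  rw [Realification.congr_apply_eq_map, Realification.map_of, MonoidHom.coe_coe]

/-- `(Realification.congr e)⁻¹ = Realification.congr e⁻¹`. [cite: MochizukiFrdI2008, §0 p.10] -/
theorem Realification.congr_symm (e : N ≃* N') :
    (Realification.congr e).symm = Realification.congr e.symm := rfl

/-- The image of a set under `Realification.congr e` composed with `of` is the image under `of ∘ e`.
[cite: MochizukiFrdI2008, §0 p.10] -/
theorem Realification.congr_image_of (e : N ≃* N') (S : Set N) :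
    Realification.congr e '' (Realification.of N '' S) = Realification.of N' '' (e '' S) := by
  rw [Set.image_image, Set.image_image]
  exact Set.image_congr fun a _ => Realification.congr_of e a

end Literature.AlgebraicGeometry.Frobenioids
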